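import Summits.QuantumFields.YangMills.Theorems.UV3FibreDerivativeLipschitz
import Summits.QuantumFields.YangMills.Theorems.BalabanUVNodesN08HaarCompatibilityGuardCoreChartTarget
import Summits.QuantumFields.YangMills.Theorems.BalabanUVNodesN08HaarCompatibilityGuardInjectivityWindows
import HarnessLib

/-!
# R3 (cell `ym3-torus`, YM₃ on T³ — a ladder RUNG, NOT d = 4, NOT infinite volume, NOT a mass gap, NOT the Clay problem) —
# **(H_K ∀-L, brick B3b) LOCAL INJECTIVITY OF THE PRINTED exp-mean-log FIBRE MAP ON CHART BALLS OF RADIUS `∝ (1 − Σcᵢ)`: `A ↦ k(u₀·e^{ι(rev A)})` and its chart conjugate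
# `ψc` are INJECTIVE on `ball 0 r` whenever `600·r ≤ (1 − Σcᵢ)·sin 1` — the `hinj` binder of the multi-window frame, for EVERY `Σcᵢ < 1`**

Width seat `ym-ust-19936-w8` g13 on crux `stmt-QuantumFields-19936` `UnitScaleTilt.HistoryTailL` (`--supports`, helper; THEOREMS ONLY, 0 `def`, 0 `sorry`); ★★OWNER WORD 99
(2026-08-30) (ii).  Sequel of B3a ✓`UV3FibreDerivativeLipschitz` (Λ₂, `K₁`) over bricks B1 ✓`UV3ExpFDerivLipschitz`, B2 ✓`UV3QlogDerivativeBounds`; tree letters BY IMPORT: n08-w3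
✓`…GuardChartLift.exists_kD_mul_eq` (the tangent floor, every `Σcᵢ ≤ 1`), ✓`…GuardCoreInjective.Yf_re_eq_zero`, ✓`…GuardCoreChartTarget.chart_conj_of_target` (`z·e^{ι(rev ψc A)} = k(w_A)`),
n08-w6 ✓`…GuardInjectivityWindows.injOn_of_norm_fderiv_sub_le_of_sub` (injectivity on a convex window from a floor on differences and a derivative-oscillation bound), lit
✓`T4EMLFibreAC.hasStrictFDerivAt_kf`, Mathlib `hasFDerivAt_exp_zero`.

THE MATHEMATICS.  Through print's chart `A ↦ w_A = u₀·e^{ι(rev A)}` (`ι = imQuat`; `‖w_A − u₀‖ ≤ ‖A‖`) the map `f(A) = k(w_A)` has derivative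
`f′(A) = k′(w_A) ∘ (u₀·) ∘ D exp(ι(rev A)) ∘ ι∘rev` on `‖A‖ ≤ 1∕24` (§3); at the centre `f′(0) h = k′(u₀)(u₀·ι(rev h))` has the TANGENT FLOOR `(1 − Σcᵢ)·sin 1·‖h‖ ≤ ‖f′(0) h‖`
(✓`exists_kD_mul_eq`: `k′(u₀)(u₀x) = k(u₀)·y`, `‖y‖ ≥ (1 − Σcᵢ)·sinc‖Y‖·‖x‖ ≥ (1 − Σcᵢ)·sin 1·‖x‖`); and the OSCILLATION `‖f′(A) − f′(0)‖ ≤ Λ_f·‖A‖`,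
`Λ_f = e^{1∕24}·(Λ₂ + K₁) ≤ 300` (`f′(A) − f′(0) = (k′(w_A) − k′(u₀))∘M_A + k′(u₀)∘(M_A − M_0)`, B3a + B1 at `R = 1∕24`).  Hence (§4) **`f` is INJECTIVE on `ball 0 r`
whenever `Λ_f·r < (1 − Σcᵢ)·sin 1`, in particular for `600·r ≤ (1 − Σcᵢ)·sin 1` — a radius LINEAR in `λ′ = 1 − Σcᵢ = L^{1−d}`** — and (§5) so is the chart conjugate
`ψc(A) = rev(imVec(qlog(z̄·f(A))))` on any `W ⊆ ball 0 r` carrying part 29C's log-ball letters, because `z·e^{ι(rev ψc A)} = f(A)` makes `f` a function of `ψc`.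

HOW IT DOCKS (assembly day — NOT this generation, ★★OWNER WORD 99): in n08-w3 part 21 ✓`…GuardChartTransfer.haar_map_le_of_windows` take windows `W k = ball 0 r ∩ {A | w_k·expPauli A ∈ S}`
with centres `w_k ∈ S` from B4 ✓`UV3WindowNetSU2.exists_window_cover_subset_inter` (`#K ≤ (4π∕r + 3)⁴`), `r = (1 − Σcᵢ)·sin 1∕600`; per window `hder`∕floor∕`hm` from
✓`exists_hasFDerivAt_chart_of_target` + ✓`haarJacobianFloor_of_det_floor` exactly as in 29C, `hconj`∕`hmaps` from ✓`chart_conj_of_target`, and **`hinj` from THIS file's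
`injOn_chartConj_numeral`** (the quaternion letters `aᵢ = su2Quat (V i)`, `u₀ = su2Quat w_k`, guard `< 1∕3` by ✓`quat_guard`); `K(L) = κ₀⁻³·#K + 1 = poly(L)`.

CONTENTS.  §3 `norm_chartPoint`, `hasFDerivAt_kf_chart`, `norm_inner_apply_le`, `norm_inner_apply_sub_le`, ★ `norm_chartDeriv_zero_apply_ge` (floor), ★ `norm_chartDeriv_sub_le` (Λ_f),
numeral `Λf_le` (`≤ 300`).  §4 ★★ `injOn_kf_chart` · ★★ `injOn_kf_chart_numeral`.  §5 ★★ `injOn_chartConj` · ★★ `injOn_chartConj_numeral`.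

HONEST SCOPE.  Calculus; nothing of (H_K) at `L ≥ 21`, hTop, the χ record, (O‴χₛ), EX, `HistoryTailL` (19936) or any summit statement is proved here; hTop is SUPPLY w.r.t. the
registered 19936 v6 door (★★OWNER WORD 98); NO assembly this generation.  YM₃ on T³ is rung R3 — NOT d = 4, NOT infinite volume, NOT a mass gap, NOT the Clay problem; the
Yang–Mills mass gap is NOT proved.

References (orientation only; every declaration is kernel-proved [folklore]): T. Bałaban, Commun. Math. Phys. **109** (1987) 249–301 [Balaban1987RG1] ((0.4) p. 253);
T. Bałaban, Commun. Math. Phys. **102** (1985) 255–275 [Balaban1985UV3] (p. 260, the chart `dU′ = σ(A′)dA′`).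
-/

set_option autoImplicit false

noncomputable section

open NormedSpace Set Metric Function
open scoped RealInnerProductSpace Topology Quaternion

namespace Summit.QuantumFields.YangMills.Theorems.UV3FibreLocalInjectivity

open Literature.MathematicalPhysics.QuantumFieldTheory.Balaban1983to89
open Literature.MathematicalPhysics.QuantumFieldTheory.Balaban1983to89.T4QuatExpLog
open Literature.MathematicalPhysics.QuantumFieldTheory.Balaban1983to89.T4EMLFibreAC
open Literature.MathematicalPhysics.QuantumFieldTheory.Balaban1983to89.T4HaarSU2ExpChart (imQuat imQuat_re norm_imQuat)
open Literature.MathematicalPhysics.QuantumFieldTheory.Balaban1983to89.T4ExpWindowSmallField (imVec)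
open Literature.MathematicalPhysics.QuantumFieldTheory.Balaban1983to89.B10Eq18SigmaSU2Haar (rev rev_rev norm_rev)
open Summit.QuantumFields.YangMills.BalabanUVNodes.N08HaarCompatibilityGuardChartLift (exists_kD_mul_eq)
open Summit.QuantumFields.YangMills.BalabanUVNodes.N08HaarCompatibilityGuardCoreInjective (Yf_re_eq_zero)
open Summit.QuantumFields.YangMills.BalabanUVNodes.N08HaarCompatibilityGuardCoreChartTarget (chart_conj_of_target)
open Summit.QuantumFields.YangMills.BalabanUVNodes.N08HaarCompatibilityGuardInjectivityWindows (injOn_of_norm_fderiv_sub_le_of_sub)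
open Summit.QuantumFields.YangMills.Theorems.UV3ExpFDerivLipschitz (norm_fderiv_exp_sub_le norm_fderiv_exp_le' norm_exp_sub_exp_le_of_norm_le)
open Summit.QuantumFields.YangMills.Theorems.UV3QlogDerivativeBounds (floor_pos floor_ge exp_three_fifths_lt norm_qlog_le_three_fifths norm_fderiv_qlog_le
  norm_qlog_sub_qlog_le norm_fderiv_qlog_sub_le inv_floor_le_six lipschitz_const_le)
open Summit.QuantumFields.YangMills.Theorems.UV3FibreDerivativeLipschitz

variable {ι : Type*} [Fintype ι]

/-! ## §3 The chart map `f(A) = k(u₀·e^{ι(rev A)})`: derivative, tangent floor at `0`, oscillation of the derivative -/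

section Chart

variable {a : ι → ℍ} (c : ι → ℝ) {u₀ : ℍ}

/-- The point `w_A = u₀·e^{ι(rev A)}` is a unit quaternion within `‖A‖` of `u₀`. [folklore] -/
theorem norm_chartPoint (hu₀ : ‖u₀‖ = 1) (A : EuclideanSpace ℝ (Fin 3)) :
    ‖u₀ * exp (imQuat (rev A))‖ = 1 ∧ ‖u₀ * exp (imQuat (rev A)) - u₀‖ ≤ ‖A‖ := by
  have hBre : (imQuat (rev A)).re = 0 := imQuat_re _
  refine ⟨by rw [norm_mul, hu₀, norm_exp_of_re_eq_zero hBre, mul_one], ?_⟩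
  calc ‖u₀ * exp (imQuat (rev A)) - u₀‖ = ‖u₀ * (exp (imQuat (rev A)) - 1)‖ := by rw [mul_sub, mul_one]
    _ = ‖exp (imQuat (rev A)) - 1‖ := by rw [norm_mul, hu₀, one_mul]
    _ ≤ ‖imQuat (rev A)‖ := norm_exp_sub_one_le hBre
    _ = ‖A‖ := by rw [norm_imQuat, norm_rev]

/-- **THE CHART MAP IS DIFFERENTIABLE** on `‖A‖ ≤ 1∕24` with derivative `f′(A) = k′(w_A) ∘ (u₀·) ∘ D exp(ι(rev A)) ∘ ι∘rev` (chain rule; lit ✓`hasStrictFDerivAt_kf` at the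
guarded point `w_A`). [folklore] -/
theorem hasFDerivAt_kf_chart (ha : ∀ i, ‖a i‖ = 1) (hu₀ : ‖u₀‖ = 1) (hg : ∀ i, ‖a i * star u₀ - 1‖ ≤ 1 / 3)
    {A : EuclideanSpace ℝ (Fin 3)} (hA : ‖A‖ ≤ 1 / 24) :
    HasFDerivAt (fun A : EuclideanSpace ℝ (Fin 3) => kf a c (u₀ * exp (imQuat (rev A))))
      ((kD a c (u₀ * exp (imQuat (rev A)))).comp ((ContinuousLinearMap.mul ℝ ℍ u₀).comp ((fderiv ℝ exp (imQuat (rev A))).comp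
        ((imQuat.toContinuousLinearMap).comp (rev.toContinuousLinearEquiv : EuclideanSpace ℝ (Fin 3) →L[ℝ] EuclideanSpace ℝ (Fin 3)))))) A := by
  set I : EuclideanSpace ℝ (Fin 3) →L[ℝ] ℍ := (imQuat.toContinuousLinearMap).comp
    (rev.toContinuousLinearEquiv : EuclideanSpace ℝ (Fin 3) →L[ℝ] EuclideanSpace ℝ (Fin 3)) with hI_def
  have hIder : HasFDerivAt (fun A : EuclideanSpace ℝ (Fin 3) => imQuat (rev A)) I A := I.hasFDerivAt
  have hE : HasFDerivAt (fun A : EuclideanSpace ℝ (Fin 3) => u₀ * exp (imQuat (rev A)))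
      ((ContinuousLinearMap.mul ℝ ℍ u₀).comp ((fderiv ℝ exp (imQuat (rev A))).comp I)) A := by
    have h1 := (hasFDerivAt_exp (imQuat (rev A))).comp A hIder
    exact h1.const_mul u₀
  have hw := norm_chartPoint hu₀ A
  have hg1 : ∀ i, ‖a i * star (u₀ * exp (imQuat (rev A))) - 1‖ < 1 := fun i =>
    (norm_mul_star_sub_one_le_region (ha i) (hg i) (hw.2.trans hA)).trans_lt (by norm_num)
  have hK : HasFDerivAt (kf a c) (kD a c (u₀ * exp (imQuat (rev A)))) (u₀ * exp (imQuat (rev A))) := (hasStrictFDerivAt_kf c hg1).hasFDerivAt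
  exact hK.comp A hE

/-- The inner chart derivative is `e^{1∕24}`-bounded: `‖u₀·D exp(ι(rev A))(ι(rev h))‖ ≤ e^{1∕24}‖h‖` for `‖A‖ ≤ 1∕24` (B1 `norm_fderiv_exp_le'`). [folklore] -/
theorem norm_inner_apply_le (hu₀ : ‖u₀‖ = 1) {A : EuclideanSpace ℝ (Fin 3)} (hA : ‖A‖ ≤ 1 / 24) (h : EuclideanSpace ℝ (Fin 3)) :
    ‖u₀ * fderiv ℝ exp (imQuat (rev A)) (imQuat (rev h))‖ ≤ Real.exp (1 / 24) * ‖h‖ := by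
  rw [norm_mul, hu₀, one_mul]
  calc ‖fderiv ℝ exp (imQuat (rev A)) (imQuat (rev h))‖ ≤ ‖fderiv ℝ (exp : ℍ → ℍ) (imQuat (rev A))‖ * ‖imQuat (rev h)‖ := ContinuousLinearMap.le_opNorm _ _
    _ ≤ Real.exp (1 / 24) * ‖h‖ := by
        rw [norm_imQuat, norm_rev]
        refine mul_le_mul_of_nonneg_right ((norm_fderiv_exp_le' _).trans (Real.exp_le_exp.2 ?_)) (norm_nonneg _)
        rwa [norm_imQuat, norm_rev]

/-- The inner chart derivative moves by `≤ e^{1∕24}·‖A‖·‖h‖` between `A` and `0` (B1 ★`norm_fderiv_exp_sub_le` at `R = 1∕24`). [folklore] -/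
theorem norm_inner_apply_sub_le (hu₀ : ‖u₀‖ = 1) {A : EuclideanSpace ℝ (Fin 3)} (hA : ‖A‖ ≤ 1 / 24) (h : EuclideanSpace ℝ (Fin 3)) :
    ‖u₀ * fderiv ℝ exp (imQuat (rev A)) (imQuat (rev h)) - u₀ * fderiv ℝ exp (imQuat (rev (0 : EuclideanSpace ℝ (Fin 3)))) (imQuat (rev h))‖ ≤
      Real.exp (1 / 24) * ‖A‖ * ‖h‖ := by
  have h0 : imQuat (rev (0 : EuclideanSpace ℝ (Fin 3))) = 0 := by simp
  rw [← mul_sub, norm_mul, hu₀, one_mul, ← sub_apply, h0]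
  calc ‖(fderiv ℝ (exp : ℍ → ℍ) (imQuat (rev A)) - fderiv ℝ (exp : ℍ → ℍ) (0 : ℍ)) (imQuat (rev h))‖
      ≤ ‖fderiv ℝ (exp : ℍ → ℍ) (imQuat (rev A)) - fderiv ℝ (exp : ℍ → ℍ) (0 : ℍ)‖ * ‖imQuat (rev h)‖ := ContinuousLinearMap.le_opNorm _ _
    _ ≤ (Real.exp (1 / 24) * ‖imQuat (rev A) - 0‖) * ‖h‖ := by
        rw [norm_imQuat, norm_rev]
        refine mul_le_mul_of_nonneg_right (norm_fderiv_exp_sub_le ?_ ?_) (norm_nonneg _)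
        · rwa [norm_imQuat, norm_rev]
        · rw [norm_zero]; positivity
    _ = Real.exp (1 / 24) * ‖A‖ * ‖h‖ := by rw [sub_zero, norm_imQuat, norm_rev]

/-- ★ **THE TANGENT FLOOR AT THE CENTRE**: `(1 − Σcᵢ)·sin 1·‖h‖ ≤ ‖f′(0) h‖` — `f′(0) h = k′(u₀)(u₀·ι(rev h))` (`D exp(0) = id`) and n08-w3 ✓`exists_kD_mul_eq`
(`k′(u₀)(u₀x) = k(u₀)·y`, `‖y‖ ≥ (1 − Σcᵢ)·sinc‖Y‖·‖x‖`, `sinc‖Y‖ ≥ sin 1`). [folklore] -/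
theorem norm_chartDeriv_zero_apply_ge (ha : ∀ i, ‖a i‖ = 1) (hc : ∀ i, 0 ≤ c i) (hs : ∑ i, c i ≤ 1) (hu₀ : ‖u₀‖ = 1)
    (hg : ∀ i, ‖a i * star u₀ - 1‖ ≤ 1 / 3) (h : EuclideanSpace ℝ (Fin 3)) :
    (1 - ∑ i, c i) * Real.sin 1 * ‖h‖ ≤
      ‖((kD a c (u₀ * exp (imQuat (rev (0 : EuclideanSpace ℝ (Fin 3)))))).comp ((ContinuousLinearMap.mul ℝ ℍ u₀).comp
        ((fderiv ℝ exp (imQuat (rev (0 : EuclideanSpace ℝ (Fin 3))))).comp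
          ((imQuat.toContinuousLinearMap).comp (rev.toContinuousLinearEquiv : EuclideanSpace ℝ (Fin 3) →L[ℝ] EuclideanSpace ℝ (Fin 3)))))) h‖ := by
  have h0 : imQuat (rev (0 : EuclideanSpace ℝ (Fin 3))) = 0 := by simp
  have hD0 : fderiv ℝ (exp : ℍ → ℍ) 0 = ContinuousLinearMap.id ℝ ℍ := by
    rw [(hasFDerivAt_exp_zero (𝕂 := ℝ) (𝔸 := ℍ)).fderiv, ContinuousLinearMap.one_def]
  have happ : ((kD a c (u₀ * exp (imQuat (rev (0 : EuclideanSpace ℝ (Fin 3)))))).comp ((ContinuousLinearMap.mul ℝ ℍ u₀).comp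
        ((fderiv ℝ exp (imQuat (rev (0 : EuclideanSpace ℝ (Fin 3))))).comp
          ((imQuat.toContinuousLinearMap).comp (rev.toContinuousLinearEquiv : EuclideanSpace ℝ (Fin 3) →L[ℝ] EuclideanSpace ℝ (Fin 3)))))) h =
      kD a c u₀ (u₀ * imQuat (rev h)) := by
    simp only [ContinuousLinearMap.comp_apply, ContinuousLinearMap.mul_apply', h0, exp_zero, mul_one, hD0, ContinuousLinearMap.id_apply]
    rfl
  rw [happ]
  have hg2 : ∀ i, ‖a i * star u₀ - 1‖ < 1 / 2 := fun i => (hg i).trans_lt (by norm_num)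
  have hxre : (imQuat (rev h)).re = 0 := imQuat_re _
  obtain ⟨y, -, hy, hyn⟩ := exists_kD_mul_eq c hu₀ ha hc hs hg2 hxre
  rw [hy, norm_mul]
  have hYre : (Yf a c u₀).re = 0 := Yf_re_eq_zero c hu₀ ha hc hs hg2
  have hk1 : ‖kf a c u₀‖ = 1 := by rw [kf, norm_mul, norm_exp_of_re_eq_zero hYre, hu₀, one_mul]
  rw [hk1, one_mul]
  refine le_trans ?_ hyn
  rw [norm_imQuat, norm_rev]
  -- `sin 1 ≤ sinc ‖Y‖` since `‖Y‖ ≤ 1`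
  have hY1 : ‖Yf a c u₀‖ ≤ 1 := by
    rw [Yf]
    refine (norm_sum_le _ _).trans ((Finset.sum_le_sum fun i _ => ?_).trans hs)
    rw [norm_smul, Real.norm_of_nonneg (hc i)]
    exact (mul_le_mul_of_nonneg_left (norm_qlog_lt_one (hg2 i)).le (hc i)).trans_eq (mul_one _)
  have hsincY : Real.sin 1 ≤ Real.sinc ‖Yf a c u₀‖ := by
    rcases eq_or_ne ‖Yf a c u₀‖ 0 with h0' | h0'
    · rw [h0', Real.sinc_zero]; exact Real.sin_le_one 1
    · rw [Real.sinc_of_ne_zero h0']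
      have hpos : 0 < ‖Yf a c u₀‖ := (norm_nonneg _).lt_of_ne' h0'
      have := Summit.QuantumFields.YangMills.BalabanUVNodes.N08HaarCompatibilityGuardJacobian.sin_div_le_sin_div hpos hY1 (by linarith [Real.pi_gt_three])
      simpa using this
  have hsl : 0 ≤ 1 - ∑ i, c i := by linarith
  calc (1 - ∑ i, c i) * Real.sin 1 * ‖h‖ ≤ (1 - ∑ i, c i) * Real.sinc ‖Yf a c u₀‖ * ‖h‖ := by gcongr
    _ = _ := rfl

/-- ★ **THE DERIVATIVE OSCILLATION**: `‖f′(A) − f′(0)‖ ≤ Λ_f·‖A‖` on `‖A‖ ≤ 1∕24`, `Λ_f = e^{1∕24}·(Λ₂ + K₁)`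
(`f′(A) − f′(0) = (k′(w_A) − k′(u₀))∘M_A + k′(u₀)∘(M_A − M_0)`, §2 and B1). [folklore] -/
theorem norm_chartDeriv_sub_le (ha : ∀ i, ‖a i‖ = 1) (hc : ∀ i, 0 ≤ c i) (hs : ∑ i, c i ≤ 1) (hu₀ : ‖u₀‖ = 1)
    (hg : ∀ i, ‖a i * star u₀ - 1‖ ≤ 1 / 3) {A : EuclideanSpace ℝ (Fin 3)} (hA : ‖A‖ ≤ 1 / 24) :
    ‖(kD a c (u₀ * exp (imQuat (rev A)))).comp ((ContinuousLinearMap.mul ℝ ℍ u₀).comp ((fderiv ℝ exp (imQuat (rev A))).comp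
        ((imQuat.toContinuousLinearMap).comp (rev.toContinuousLinearEquiv : EuclideanSpace ℝ (Fin 3) →L[ℝ] EuclideanSpace ℝ (Fin 3))))) -
      (kD a c (u₀ * exp (imQuat (rev (0 : EuclideanSpace ℝ (Fin 3)))))).comp ((ContinuousLinearMap.mul ℝ ℍ u₀).comp
        ((fderiv ℝ exp (imQuat (rev (0 : EuclideanSpace ℝ (Fin 3))))).comp
          ((imQuat.toContinuousLinearMap).comp (rev.toContinuousLinearEquiv : EuclideanSpace ℝ (Fin 3) →L[ℝ] EuclideanSpace ℝ (Fin 3)))))‖ ≤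
      Real.exp (1 / 24) * (Real.exp (3 / 5) * (8 / 5 + (2 - Real.exp (3 / 5))⁻¹ +
        25 / 24 * (8 / 5 * (2 - Real.exp (3 / 5))⁻¹ + ((2 - Real.exp (3 / 5))⁻¹) ^ 2 * (8 / 5) * Real.exp (3 / 5))) +
        (1 + 3 / 5 * Real.exp (3 / 5) + 25 / 24 * Real.exp (3 / 5) * (2 - Real.exp (3 / 5))⁻¹)) * ‖A‖ := by
  set Λ₂ : ℝ := Real.exp (3 / 5) * (8 / 5 + (2 - Real.exp (3 / 5))⁻¹ +
        25 / 24 * (8 / 5 * (2 - Real.exp (3 / 5))⁻¹ + ((2 - Real.exp (3 / 5))⁻¹) ^ 2 * (8 / 5) * Real.exp (3 / 5))) with hΛ₂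
  set K₁ : ℝ := 1 + 3 / 5 * Real.exp (3 / 5) + 25 / 24 * Real.exp (3 / 5) * (2 - Real.exp (3 / 5))⁻¹ with hK₁
  have hM0 : 0 ≤ (2 - Real.exp (3 / 5))⁻¹ := inv_nonneg.2 floor_pos.le
  have hΛ0 : 0 ≤ Λ₂ := by positivity
  have hK0 : 0 ≤ K₁ := by positivity
  have hw := norm_chartPoint hu₀ A
  have hw0 : u₀ * exp (imQuat (rev (0 : EuclideanSpace ℝ (Fin 3)))) = u₀ := by simp
  have hwA : ‖u₀ * exp (imQuat (rev A)) - u₀‖ ≤ 1 / 24 := hw.2.trans hA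
  have hu₀r : ‖u₀ - u₀‖ ≤ 1 / 24 := by rw [sub_self, norm_zero]; positivity
  have hkk : ‖kD a c (u₀ * exp (imQuat (rev A))) - kD a c u₀‖ ≤ Λ₂ * ‖A‖ :=
    (norm_kD_sub_kD_le c ha hc hs hu₀ hg hwA hu₀r).trans (mul_le_mul_of_nonneg_left hw.2 hΛ0)
  have hk0 : ‖kD a c u₀‖ ≤ K₁ := norm_kD_le c ha hc hs hu₀ hg hu₀r
  refine ContinuousLinearMap.opNorm_le_bound _ (by positivity) fun h => ?_
  have happ : ((kD a c (u₀ * exp (imQuat (rev A)))).comp ((ContinuousLinearMap.mul ℝ ℍ u₀).comp ((fderiv ℝ exp (imQuat (rev A))).comp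
        ((imQuat.toContinuousLinearMap).comp (rev.toContinuousLinearEquiv : EuclideanSpace ℝ (Fin 3) →L[ℝ] EuclideanSpace ℝ (Fin 3))))) -
      (kD a c (u₀ * exp (imQuat (rev (0 : EuclideanSpace ℝ (Fin 3)))))).comp ((ContinuousLinearMap.mul ℝ ℍ u₀).comp
        ((fderiv ℝ exp (imQuat (rev (0 : EuclideanSpace ℝ (Fin 3))))).comp
          ((imQuat.toContinuousLinearMap).comp (rev.toContinuousLinearEquiv : EuclideanSpace ℝ (Fin 3) →L[ℝ] EuclideanSpace ℝ (Fin 3)))))) h =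
      (kD a c (u₀ * exp (imQuat (rev A))) - kD a c u₀) (u₀ * fderiv ℝ exp (imQuat (rev A)) (imQuat (rev h))) +
        kD a c u₀ (u₀ * fderiv ℝ exp (imQuat (rev A)) (imQuat (rev h)) - u₀ * fderiv ℝ exp (imQuat (rev (0 : EuclideanSpace ℝ (Fin 3)))) (imQuat (rev h))) := by
    simp only [sub_apply, ContinuousLinearMap.comp_apply, ContinuousLinearMap.mul_apply', hw0, map_sub]
    simp only [LinearMap.coe_toContinuousLinearMap', ContinuousLinearEquiv.coe_coe, LinearIsometryEquiv.coe_toContinuousLinearEquiv]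
    abel
  rw [happ]
  have t1 : ‖(kD a c (u₀ * exp (imQuat (rev A))) - kD a c u₀) (u₀ * fderiv ℝ exp (imQuat (rev A)) (imQuat (rev h)))‖ ≤ (Λ₂ * ‖A‖) * (Real.exp (1 / 24) * ‖h‖) :=
    (ContinuousLinearMap.le_opNorm _ _).trans (mul_le_mul hkk (norm_inner_apply_le hu₀ hA h) (norm_nonneg _) (by positivity))
  have t2 : ‖kD a c u₀ (u₀ * fderiv ℝ exp (imQuat (rev A)) (imQuat (rev h)) - u₀ * fderiv ℝ exp (imQuat (rev (0 : EuclideanSpace ℝ (Fin 3)))) (imQuat (rev h)))‖ ≤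
      K₁ * (Real.exp (1 / 24) * ‖A‖ * ‖h‖) :=
    (ContinuousLinearMap.le_opNorm _ _).trans (mul_le_mul hk0 (norm_inner_apply_sub_le hu₀ hA h) (norm_nonneg _) hK0)
  calc _ ≤ (Λ₂ * ‖A‖) * (Real.exp (1 / 24) * ‖h‖) + K₁ * (Real.exp (1 / 24) * ‖A‖ * ‖h‖) := (norm_add_le _ _).trans (add_le_add t1 t2)
    _ = Real.exp (1 / 24) * (Λ₂ + K₁) * ‖A‖ * ‖h‖ := by ring

/-- NUMERAL: `Λ_f = e^{1∕24}·(Λ₂ + K₁) ≤ 300` (`e^{1∕24} ≤ 1 + 1∕24 + …`; `Λ₂ ≤ 250`, `K₁ ≤ 14`). [folklore] -/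
theorem Λf_le : Real.exp (1 / 24) * (Real.exp (3 / 5) * (8 / 5 + (2 - Real.exp (3 / 5))⁻¹ +
        25 / 24 * (8 / 5 * (2 - Real.exp (3 / 5))⁻¹ + ((2 - Real.exp (3 / 5))⁻¹) ^ 2 * (8 / 5) * Real.exp (3 / 5))) +
        (1 + 3 / 5 * Real.exp (3 / 5) + 25 / 24 * Real.exp (3 / 5) * (2 - Real.exp (3 / 5))⁻¹)) ≤ (300 : ℝ) := by
  have h1 : Real.exp (1 / 24) ≤ 11 / 10 := by
    have h := Real.exp_bound (x := (1 / 24 : ℝ)) (by rw [abs_of_nonneg (by norm_num)]; norm_num) (n := 2) (by norm_num)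
    have hS : ∑ i ∈ Finset.range 2, (1 / 24 : ℝ) ^ i / (i.factorial : ℝ) = 25 / 24 := by
      simp only [Finset.sum_range_succ, Finset.sum_range_zero, Nat.factorial]
      norm_num
    rw [hS, abs_of_nonneg (by norm_num : (0 : ℝ) ≤ 1 / 24)] at h
    have h2 := (abs_sub_le_iff.1 h).1
    have h3 : (1 / 24 : ℝ) ^ 2 * ((Nat.succ 2 : ℕ) / ((Nat.factorial 2 : ℕ) * (2 : ℕ) : ℝ)) ≤ 1 / 100 := by norm_num [Nat.factorial]
    linarith
  have hsum : Real.exp (3 / 5) * (8 / 5 + (2 - Real.exp (3 / 5))⁻¹ +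
        25 / 24 * (8 / 5 * (2 - Real.exp (3 / 5))⁻¹ + ((2 - Real.exp (3 / 5))⁻¹) ^ 2 * (8 / 5) * Real.exp (3 / 5))) +
        (1 + 3 / 5 * Real.exp (3 / 5) + 25 / 24 * Real.exp (3 / 5) * (2 - Real.exp (3 / 5))⁻¹) ≤ 264 := by
    have := Λ₂_le; have := K₁_le; linarith
  have h0 : 0 ≤ Real.exp (3 / 5) * (8 / 5 + (2 - Real.exp (3 / 5))⁻¹ +
        25 / 24 * (8 / 5 * (2 - Real.exp (3 / 5))⁻¹ + ((2 - Real.exp (3 / 5))⁻¹) ^ 2 * (8 / 5) * Real.exp (3 / 5))) +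
        (1 + 3 / 5 * Real.exp (3 / 5) + 25 / 24 * Real.exp (3 / 5) * (2 - Real.exp (3 / 5))⁻¹) := by
    have hM0 : 0 ≤ (2 - Real.exp (3 / 5))⁻¹ := inv_nonneg.2 floor_pos.le
    positivity
  calc _ ≤ 11 / 10 * 264 := mul_le_mul h1 hsum h0 (by norm_num)
    _ ≤ 300 := by norm_num

/-! ## §4 ★★ Local injectivity of the fibre map on chart balls of radius `∝ (1 − Σcᵢ)` -/

/-- ★★ **LOCAL INJECTIVITY OF THE PRINTED FIBRE MAP THROUGH THE CHART.**  Unit `aᵢ`, `cᵢ ≥ 0`, `Σcᵢ ≤ 1`; a unit `u₀` with `‖aᵢū₀ − 1‖ ≤ 1∕3` (print's guard);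
`0 < r ≤ 1∕24` with `Λ_f·r < (1 − Σcᵢ)·sin 1`.  Then `A ↦ k(u₀·e^{ι(rev A)})` is INJECTIVE on `ball 0 r ⊂ ℝ³` — n08-w6 ✓`injOn_of_norm_fderiv_sub_le_of_sub` with
`L := f′(0)` (floor `(1 − Σcᵢ)·sin 1`, §3) and the oscillation `‖f′(A) − f′(0)‖ ≤ Λ_f·r` (§3). [folklore] -/
theorem injOn_kf_chart (ha : ∀ i, ‖a i‖ = 1) (hc : ∀ i, 0 ≤ c i) (hs : ∑ i, c i ≤ 1) (hu₀ : ‖u₀‖ = 1)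
    (hg : ∀ i, ‖a i * star u₀ - 1‖ ≤ 1 / 3) {r : ℝ} (hr24 : r ≤ 1 / 24)
    (hr : Real.exp (1 / 24) * (Real.exp (3 / 5) * (8 / 5 + (2 - Real.exp (3 / 5))⁻¹ +
        25 / 24 * (8 / 5 * (2 - Real.exp (3 / 5))⁻¹ + ((2 - Real.exp (3 / 5))⁻¹) ^ 2 * (8 / 5) * Real.exp (3 / 5))) +
        (1 + 3 / 5 * Real.exp (3 / 5) + 25 / 24 * Real.exp (3 / 5) * (2 - Real.exp (3 / 5))⁻¹)) * r < (1 - ∑ i, c i) * Real.sin 1) :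
    InjOn (fun A : EuclideanSpace ℝ (Fin 3) => kf a c (u₀ * exp (imQuat (rev A)))) (ball (0 : EuclideanSpace ℝ (Fin 3)) r) := by
  set f' : EuclideanSpace ℝ (Fin 3) → (EuclideanSpace ℝ (Fin 3) →L[ℝ] ℍ) := fun A =>
    (kD a c (u₀ * exp (imQuat (rev A)))).comp ((ContinuousLinearMap.mul ℝ ℍ u₀).comp ((fderiv ℝ exp (imQuat (rev A))).comp
      ((imQuat.toContinuousLinearMap).comp (rev.toContinuousLinearEquiv : EuclideanSpace ℝ (Fin 3) →L[ℝ] EuclideanSpace ℝ (Fin 3))))) with hf'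
  have hmem : ∀ {z : EuclideanSpace ℝ (Fin 3)}, z ∈ ball (0 : EuclideanSpace ℝ (Fin 3)) r → ‖z‖ ≤ 1 / 24 := fun hz =>
    ((mem_ball_zero_iff.1 hz).le).trans hr24
  refine injOn_of_norm_fderiv_sub_le_of_sub (f' := f') (convex_ball _ _) (fun z hz => (hasFDerivAt_kf_chart c ha hu₀ hg (hmem hz)).hasFDerivWithinAt)
    (f' 0) (l := (1 - ∑ i, c i) * Real.sin 1) (fun x _ y _ => ?_) (fun z hz => ?_) hr
  · exact norm_chartDeriv_zero_apply_ge c ha hc hs hu₀ hg (y - x)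
  · have h := norm_chartDeriv_sub_le c ha hc hs hu₀ hg (hmem hz)
    refine h.trans (mul_le_mul_of_nonneg_left (mem_ball_zero_iff.1 hz).le ?_)
    have hM0 : 0 ≤ (2 - Real.exp (3 / 5))⁻¹ := inv_nonneg.2 floor_pos.le
    positivity

/-- ★★ **NUMERAL EDITION**: `600·r ≤ (1 − Σcᵢ)·sin 1` and `Σcᵢ < 1` suffice — an injectivity radius LINEAR in `λ′ = 1 − Σcᵢ` (`= L^{1−d}` at print's weights).
[folklore] -/
theorem injOn_kf_chart_numeral (ha : ∀ i, ‖a i‖ = 1) (hc : ∀ i, 0 ≤ c i) (hs : ∑ i, c i < 1) (hu₀ : ‖u₀‖ = 1)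
    (hg : ∀ i, ‖a i * star u₀ - 1‖ ≤ 1 / 3) {r : ℝ} (hr0 : 0 ≤ r) (hr : 600 * r ≤ (1 - ∑ i, c i) * Real.sin 1) :
    InjOn (fun A : EuclideanSpace ℝ (Fin 3) => kf a c (u₀ * exp (imQuat (rev A)))) (ball (0 : EuclideanSpace ℝ (Fin 3)) r) := by
  have hsin1 : Real.sin 1 ≤ 1 := Real.sin_le_one 1
  have hsin0 : 0 < Real.sin 1 := Real.sin_pos_of_pos_of_lt_pi one_pos (by linarith [Real.pi_gt_three])
  have hl : 0 < (1 - ∑ i, c i) * Real.sin 1 := mul_pos (by linarith) hsin0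
  have hs0 : 0 ≤ ∑ i, c i := Finset.sum_nonneg fun i _ => hc i
  have h1s : (1 - ∑ i, c i) * Real.sin 1 ≤ 1 :=
    calc (1 - ∑ i, c i) * Real.sin 1 ≤ 1 * 1 := mul_le_mul (by linarith) hsin1 hsin0.le zero_le_one
      _ = 1 := one_mul 1
  have hr24 : r ≤ 1 / 24 := by linarith
  refine injOn_kf_chart c ha hc hs.le hu₀ hg hr24 (lt_of_le_of_lt (mul_le_mul_of_nonneg_right Λf_le hr0) ?_)
  linarith

/-! ## §5 ★★ The chart CONJUGATE is injective on the same ball (the frame's `hinj`) -/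

/-- ★★ **THE `hinj` BINDER OF THE MULTI-WINDOW FRAME.**  Under §4's hypotheses, for any unit target centre `z` and any `W ⊆ ball 0 r` on which the log-ball letters of
part 29C hold (`‖z̄·f(A)‖ = 1`, `‖z̄·f(A) − 1‖ < 1`), the chart conjugate `ψc(A) = rev(imVec(qlog(z̄·f(A))))` is INJECTIVE on `W` — because `z·e^{ι(rev ψc A)} = f(A)`
(✓`chart_conj_of_target`) makes `f` a function of `ψc`, and `f` is injective (§4). [folklore] -/
theorem injOn_chartConj (ha : ∀ i, ‖a i‖ = 1) (hc : ∀ i, 0 ≤ c i) (hs : ∑ i, c i ≤ 1) (hu₀ : ‖u₀‖ = 1)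
    (hg : ∀ i, ‖a i * star u₀ - 1‖ ≤ 1 / 3) {r : ℝ} (hr24 : r ≤ 1 / 24)
    (hr : Real.exp (1 / 24) * (Real.exp (3 / 5) * (8 / 5 + (2 - Real.exp (3 / 5))⁻¹ +
        25 / 24 * (8 / 5 * (2 - Real.exp (3 / 5))⁻¹ + ((2 - Real.exp (3 / 5))⁻¹) ^ 2 * (8 / 5) * Real.exp (3 / 5))) +
        (1 + 3 / 5 * Real.exp (3 / 5) + 25 / 24 * Real.exp (3 / 5) * (2 - Real.exp (3 / 5))⁻¹)) * r < (1 - ∑ i, c i) * Real.sin 1)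
    {z : ℍ} (hz : ‖z‖ = 1) {W : Set (EuclideanSpace ℝ (Fin 3))} (hW : W ⊆ ball (0 : EuclideanSpace ℝ (Fin 3)) r)
    (hv : ∀ A ∈ W, ‖star z * kf a c (u₀ * exp (imQuat (rev A)))‖ = 1 ∧ ‖star z * kf a c (u₀ * exp (imQuat (rev A))) - 1‖ < 1) :
    InjOn (fun A : EuclideanSpace ℝ (Fin 3) => rev (imVec (qlog (star z * kf a c (u₀ * exp (imQuat (rev A))))))) W := by
  intro A₁ hA₁ A₂ hA₂ heq
  have h1 := (chart_conj_of_target c hz (hv A₁ hA₁).1 (hv A₁ hA₁).2).1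
  have h2 := (chart_conj_of_target c hz (hv A₂ hA₂).1 (hv A₂ hA₂).2).1
  have hf : kf a c (u₀ * exp (imQuat (rev A₁))) = kf a c (u₀ * exp (imQuat (rev A₂))) := by
    rw [← h1, ← h2]
    exact congrArg (fun B : EuclideanSpace ℝ (Fin 3) => z * exp (imQuat (rev B))) heq
  exact injOn_kf_chart c ha hc hs hu₀ hg hr24 hr (hW hA₁) (hW hA₂) hf

/-- ★★ Numeral edition of §5 (`600·r ≤ (1 − Σcᵢ)·sin 1`, `Σcᵢ < 1`). [folklore] -/
theorem injOn_chartConj_numeral (ha : ∀ i, ‖a i‖ = 1) (hc : ∀ i, 0 ≤ c i) (hs : ∑ i, c i < 1) (hu₀ : ‖u₀‖ = 1)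
    (hg : ∀ i, ‖a i * star u₀ - 1‖ ≤ 1 / 3) {r : ℝ} (hr0 : 0 ≤ r) (hr : 600 * r ≤ (1 - ∑ i, c i) * Real.sin 1)
    {z : ℍ} (hz : ‖z‖ = 1) {W : Set (EuclideanSpace ℝ (Fin 3))} (hW : W ⊆ ball (0 : EuclideanSpace ℝ (Fin 3)) r)
    (hv : ∀ A ∈ W, ‖star z * kf a c (u₀ * exp (imQuat (rev A)))‖ = 1 ∧ ‖star z * kf a c (u₀ * exp (imQuat (rev A))) - 1‖ < 1) :
    InjOn (fun A : EuclideanSpace ℝ (Fin 3) => rev (imVec (qlog (star z * kf a c (u₀ * exp (imQuat (rev A))))))) W := by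
  intro A₁ hA₁ A₂ hA₂ heq
  have h1 := (chart_conj_of_target c hz (hv A₁ hA₁).1 (hv A₁ hA₁).2).1
  have h2 := (chart_conj_of_target c hz (hv A₂ hA₂).1 (hv A₂ hA₂).2).1
  have hf : kf a c (u₀ * exp (imQuat (rev A₁))) = kf a c (u₀ * exp (imQuat (rev A₂))) := by
    rw [← h1, ← h2]
    exact congrArg (fun B : EuclideanSpace ℝ (Fin 3) => z * exp (imQuat (rev B))) heq
  exact injOn_kf_chart_numeral c ha hc hs hu₀ hg hr0 hr (hW hA₁) (hW hA₂) hf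

end Chart

end Summit.QuantumFields.YangMills.Theorems.UV3FibreLocalInjectivity

end
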